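/-
Origin: expansion seat `planner-pub-hodgecm-pv05-g2-0`, handover 2026-08-18T04:48:11Z (`HOME/pub-hodgecm-pv05-g2/lean/Pv05g2/ArchCAnalytic.lean`, md5 967a7e28, 364 lines);
landed by the gen-6 packager in gate run 22 as `HodgeCM/PerL34/ArchCAnalytic.lean` (verbatim).
-/
/-
  HodgeCM/PerL34/ArchCAnalytic.lean        (origin: pub-hodgecm-pv05-g2, WIP module `Pv05g2.ArchCAnalytic`)

  # The two ANALYTIC [SETUP] fields of the Lemma-4.1(c) datum, reduced to their calculus content

  `ArchC.lean` (pv06, node N29 = [PerL] v5 Lemma 4.1(c), ll. 513–523) posits, among the [SETUP D4/D5/D7]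
  fields of `ArchCDatum C D P`, two hypotheses that HIDE an inference rather than a construction
  (referee-3 remark recorded in the docstring of `ArchCDatum.inf_invariance`; LEMMAS.md §9 seam S4):

  * `pure_detect`    — "restricting to pure tensors" (l. 514–515): a non-zero point value 𝒯_Φ(v)(g) is
                       detected by a pure tensor φ ⊗ Φ_f;
  * `inf_invariance` — "invariance (⟨Xφ,v⟩ = −⟨φ,Xv⟩)" (l. 517): the derivative at s = 0 of the GROUP
                       invariance 𝒯_{ω(h)Φ}(R(h)v) = 𝒯_Φ(v) ([NODE N21], h = exp(sX)).

  pv12-g2's Fock bridge (`FockArchBridge`, run-22 queue) carries both verbatim.  THIS FILE proves the two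
  inferences in the kernel, so that what remains posited is only STRUCTURE of the intended model:

  (a) `pure_detect_of_dense`:  `pure_detect` ⇐ Φ ↦ 𝒯_Φ is LINEAR on 𝒮^κ [SETUP D4, l. 378–381]
      + Φ ↦ 𝒯_Φ(v)(g) is CONTINUOUS on 𝒮^κ [SETUP D4, l. 343, 356–358] + the pure tensors φ ⊗ Φ_f SPAN A
      DENSE subspace of 𝒮^κ [SETUP D4/D5: 𝒮 = 𝒮_∞ ⊗̂ 𝒮(𝔸_f), Fock vectors dense, l. 341–342].
      Kernel content (`exists_apply_ne_zero_of_dense_span`, Mathlib only): the kernel of a continuous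
      linear functional is closed; if it contains a set spanning a dense subspace it is everything.

  (b) `inf_invariance_pointwise` / `inf_invariance_of_oneParam` / `inf_invariance_of_realDirections`:
      `inf_invariance` ⇐ [NODE N21] `invariance` + the DIFFERENTIABILITY of the two orbit maps at s = 0:
        s ↦ (v ↦ 𝒯_{ω(exp sX)(φ⊗Φ_f)}(v)(g)) ∈ H* with derivative v ↦ 𝒯_{(ω(X)φ)⊗Φ_f}(v)(g)
          [SETUP D5: Fock vectors are smooth vectors of ω_∞ with dω = the Fock-model action, and
           Φ ↦ 𝒯_Φ(·)(g) : 𝒮^κ → H* is continuous linear — the referee-3 joint-continuity remark],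
        s ↦ R(exp sX)v ∈ H with derivative dR(X)v for Gårding vectors v
          [SETUP D7; print: Getz–Hahn, *An Introduction to Automorphic Representations* (GTM 300,
           2024), §4.2, Lemma 4.2.2 / Prop. 4.2.3, pp. 75–76 — the pages already cited by `ArchCDatum.Sm/Y`].
      Kernel content (`clm_apply_deriv_eq_zero_of_const`, Mathlib only): the Leibniz rule
      `HasDerivAt.clm_apply` for the ℝ-bilinear evaluation pairing H* × H → ℂ and uniqueness of
      derivatives, applied to the CONSTANT function s ↦ 𝒯_{ω(e(s))Φ}(R(e(s))v)(g); the read-back at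
      s = 0 uses only e(0) = 1, R(1) = 1 and `invariance` at h = 1 (no "ω(1) = id" is needed).
      Since the Fock-side family `X` of `ArchCDatum`/`FockArchBridge` ranges over 𝔲(W_∞)_ℂ (ladder
      operators are COMPLEX combinations of real directions, which have no one-parameter subgroups in
      U(W)), `inf_invariance_sum` proves that the identity is stable under finite ℂ-linear combinations
      (from `ins_add`/`ins_smul` and linearity in v), and `inf_invariance_of_realDirections` concludes the
      field for any family expressed in real directions X_j with one-parameter subgroups e_j(s) = exp(sX_j).

  (c) `ArchCDatum.withAnalytic`: BY-NAME SHAPE CERTIFICATE (no mathematical content — the input datum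
      already has the two fields): rebuilding any `ArchCDatum` with the two fields REPLACED by (a), (b)
      typechecks, i.e. (a), (b) conclude the two [SETUP] fields VERBATIM.  A future constructor of the
      datum from the adelic Weil representation (D4) supplies the structural hypotheses of (a), (b) instead.

  LABELS.  KERNEL: every `theorem` below.  Hypotheses: [NODE N21] `invariance` (pv05 `KernelOperator*` at
  the L²-kernel shell); [SETUP D4] linearity/continuity of Φ ↦ 𝒯_Φ(v)(g), density of pure tensors, the
  one-parameter subgroups; [SETUP D5] smoothness of Fock vectors; [SETUP D7] Gårding vectors.  Nothing here
  is a node of LEMMAS.md §1 (no claim cell); it sharpens seam S4 (LEMMAS.md §9) on the pv05 side (N21 ⇒ its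
  infinitesimal form).  No new cited fact; no statement of [PerL]/[QW8]/2001 enters as a hypothesis.

  Mathlib only beyond `HodgeCM.PerL34.ArchC`; no placeholders.
-/
import Summits.HodgeConjecture.HodgeCM.PerL34.ArchC_2
import Mathlib.Analysis.Calculus.Deriv.Mul
import Mathlib.Analysis.Calculus.Deriv.Comp
import Mathlib.Analysis.Normed.Operator.Basic

set_option autoImplicit false

noncomputable section

namespace HodgeCM

namespace PerL34.ArchC

open HodgeCM.Prior.Perl34File HodgeCM.Prior.Perl34File.Perl34

/-! ## §1  Two Mathlib-only lemmas (the kernel content) -/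

section Core

/-- **Detection through a dense span** (kernel content of `pure_detect`).  If a continuous linear
functional `ℓ` on a topological vector space does not vanish at `x`, and the family `g` spans a dense
subspace, then `ℓ` does not vanish at some `g i`: the kernel of `ℓ` is closed (`isClosed_ker`), so if
it contained `range g` it would contain the closure of the span, i.e. everything. -/
theorem exists_apply_ne_zero_of_dense_span {E : Type*} [TopologicalSpace E] [AddCommGroup E]
    [Module ℂ E] (ℓ : E →L[ℂ] ℂ) {ι : Type*} (g : ι → E)
    (hd : Dense (Submodule.span ℂ (Set.range g) : Set E)) {x : E} (hx : ℓ x ≠ 0) :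
    ∃ i, ℓ (g i) ≠ 0 := by
  by_contra h
  push Not at h
  have hle : Submodule.span ℂ (Set.range g) ≤ ℓ.ker := by
    rw [Submodule.span_le]
    rintro _ ⟨i, rfl⟩
    exact LinearMap.mem_ker.mpr (h i)
  have huniv : (ℓ.ker : Set E) = Set.univ := by
    refine Set.eq_univ_of_univ_subset ?_
    rw [← hd.closure_eq]
    exact closure_minimal (SetLike.coe_subset_coe.mpr hle) ℓ.isClosed_ker
  have hx0 : x ∈ (ℓ.ker : Set E) := by
    rw [huniv]
    exact Set.mem_univ x
  exact hx (LinearMap.mem_ker.mp hx0)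

/-- **Leibniz rule for a constant pairing** (kernel content of `inf_invariance`).  For a curve of bounded
ℝ-linear functionals `u` and a curve of vectors `w`, both differentiable at `s₀`, such that the pairing
`u s (w s)` is constant: `u' (w s₀) + u s₀ w' = 0` — the product rule `HasDerivAt.clm_apply` and
uniqueness of the derivative (`HasDerivAt.unique`) against `hasDerivAt_const`. -/
theorem clm_apply_deriv_eq_zero_of_const {E : Type*} [NormedAddCommGroup E] [NormedSpace ℝ E]
    {u : ℝ → E →L[ℝ] ℂ} {u' : E →L[ℝ] ℂ} {w : ℝ → E} {w' : E} {s₀ : ℝ} {c : ℂ}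
    (hu : HasDerivAt u u' s₀) (hw : HasDerivAt w w' s₀) (hconst : ∀ s, u s (w s) = c) :
    u' (w s₀) + u s₀ w' = 0 := by
  have h₁ : HasDerivAt (fun s => u s (w s)) (u' (w s₀) + u s₀ w') s₀ := hu.clm_apply hw
  have h₂ : HasDerivAt (fun s => u s (w s)) 0 s₀ := by
    have hc : (fun s => u s (w s)) = fun _ => c := funext hconst
    rw [hc]
    exact hasDerivAt_const s₀ c
  exact h₁.unique h₂

end Core

/-! ## §2  Over the frozen interface (`IsolationCore`, `C4a.PointedCore`) -/

section Frozen

variable {H HG CG G SK SigIdx SigIdxG : Type*}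
variable [NormedAddCommGroup H] [InnerProductSpace ℂ H] [CompleteSpace H]
variable [NormedAddCommGroup HG] [InnerProductSpace ℂ HG] [CompleteSpace HG]
variable [NormedAddCommGroup CG] [NormedSpace ℂ CG]
variable [Group G] [TopologicalSpace G] [TopologicalSpace SK]
variable {C : IsolationCore H HG CG G SK SigIdx SigIdxG} {D : TorusData C} {P : C4a.PointedCore C}

/-- Unfolding of `C4a.pointFunctional`: l(v) = 𝒯_Φ(v)(g). -/
theorem pointFunctional_apply (Φ : SK) (p : P.Pt) (v : H) :
    C4a.pointFunctional C P Φ p v = P.evalPt p (C.TΦc Φ v) := rfl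

/-! ### (a) `pure_detect` from linearity, continuity in Φ, and density of the pure tensors -/

/-- [SETUP D4] Φ ↦ 𝒯_Φ(v)(g) as a BOUNDED LINEAR FUNCTIONAL on 𝒮^κ, assembled from the linearity of
Φ ↦ 𝒯_Φ (l. 378–381: θ_Φ is linear in Φ) and its continuity in Φ (l. 343, 356–358).  The linear
structure of 𝒮^κ is supplied by the caller (the frozen `SK` only carries a topology, Prior D1). -/
def evalFunctional [AddCommGroup SK] [Module ℂ SK]
    (TΦc_add : ∀ Φ Ψ : SK, C.TΦc (Φ + Ψ) = C.TΦc Φ + C.TΦc Ψ)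
    (TΦc_smul : ∀ (c : ℂ) (Φ : SK), C.TΦc (c • Φ) = c • C.TΦc Φ)
    (p : P.Pt) (v : H) (cont : Continuous fun Φ : SK => P.evalPt p (C.TΦc Φ v)) :
    SK →L[ℂ] ℂ where
  toFun Φ := P.evalPt p (C.TΦc Φ v)
  map_add' Φ Ψ := by
    simp [TΦc_add]
  map_smul' c Φ := by
    simp [TΦc_smul]
  cont := cont

/-- (Ported verbatim from the HodgeCMPerL package; no docstring in the source.) -/
@[simp] theorem evalFunctional_apply [AddCommGroup SK] [Module ℂ SK]
    (TΦc_add : ∀ Φ Ψ : SK, C.TΦc (Φ + Ψ) = C.TΦc Φ + C.TΦc Ψ)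
    (TΦc_smul : ∀ (c : ℂ) (Φ : SK), C.TΦc (c • Φ) = c • C.TΦc Φ)
    (p : P.Pt) (v : H) (cont : Continuous fun Φ : SK => P.evalPt p (C.TΦc Φ v)) (Φ : SK) :
    evalFunctional TΦc_add TΦc_smul p v cont Φ = P.evalPt p (C.TΦc Φ v) := rfl

/-- **`pure_detect` DISCHARGED** — concludes the field `ArchCDatum.pure_detect` /
`FockArchBridge.pure_detect` VERBATIM from: [SETUP D4] linearity of Φ ↦ 𝒯_Φ on 𝒮^κ (`TΦc_add`,
`TΦc_smul`), [SETUP D4] continuity of Φ ↦ 𝒯_Φ(v)(g) (`cont`, l. 343, 356–358), and [SETUP D4/D5] density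
of the span of the pure tensors φ ⊗ Φ_f, φ ∈ 𝓕^κ_∞ (`dense`; 𝒮 = 𝒮_∞ ⊗̂ 𝒮(𝔸_f) and Fock vectors are
dense, l. 341–342, 514–515).  KERNEL: `exists_apply_ne_zero_of_dense_span`. -/
theorem pure_detect_of_dense [AddCommGroup SK] [Module ℂ SK]
    (TΦc_add : ∀ Φ Ψ : SK, C.TΦc (Φ + Ψ) = C.TΦc Φ + C.TΦc Ψ)
    (TΦc_smul : ∀ (c : ℂ) (Φ : SK), C.TΦc (c • Φ) = c • C.TΦc Φ)
    (cont : ∀ (p : P.Pt) (v : H), Continuous fun Φ : SK => P.evalPt p (C.TΦc Φ v))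
    {F FinIdx : Type*} (ins : FinIdx → F → SK)
    (dense : Dense (Submodule.span ℂ (Set.range fun q : FinIdx × F => ins q.1 q.2) : Set SK)) :
    ∀ (Φ : SK) (p : P.Pt) (v : H), P.evalPt p (C.TΦc Φ v) ≠ 0 →
      ∃ (f : FinIdx) (φ : F), P.evalPt p (C.TΦc (ins f φ) v) ≠ 0 := by
  intro Φ p v hΦ
  have hx : evalFunctional TΦc_add TΦc_smul p v (cont p v) Φ ≠ 0 := hΦ
  obtain ⟨q, hq⟩ := exists_apply_ne_zero_of_dense_span
    (evalFunctional TΦc_add TΦc_smul p v (cont p v)) (fun q : FinIdx × F => ins q.1 q.2) dense hx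
  exact ⟨q.1, q.2, hq⟩

/-! ### (b) `inf_invariance` from the group invariance [NODE N21] by the Leibniz rule -/

omit [CompleteSpace H] in
variable (H) in
/-- Restriction of scalars ℂ → ℝ on bounded functionals, `H →L[ℂ] ℂ` ↦ `H →L[ℝ] ℂ`, as a bounded
ℝ-linear map (Mathlib's `ContinuousLinearMap.restrictScalarsIsometry`); used to see the evaluation
pairing H* × H → ℂ as an ℝ-bilinear map of real Banach spaces, where `HasDerivAt.clm_apply` lives. -/
def restrictReal : (H →L[ℂ] ℂ) →L[ℝ] (H →L[ℝ] ℂ) :=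
  (ContinuousLinearMap.restrictScalarsIsometry ℂ H ℂ ℝ ℝ).toContinuousLinearMap

omit [CompleteSpace H] in
/-- (Ported verbatim from the HodgeCMPerL package; no docstring in the source.) -/
@[simp] theorem restrictReal_apply (ℓ : H →L[ℂ] ℂ) (x : H) : restrictReal H ℓ x = ℓ x := rfl

/-- **`inf_invariance`, POINTWISE form, DISCHARGED.**  From [NODE N21] `invariance`
(𝒯_{ω(h)Φ}(R(h)v) = 𝒯_Φ(v), l. 382–383) along a one-parameter family `e : ℝ → U(W)(𝔸)` with
`e 0 = 1` (intended: e(s) = exp(sX), X ∈ 𝔲(W)(L₀⊗ℝ)), and the two derivatives at s = 0 —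
[SETUP D5] `hF`: s ↦ 𝒯_{ω(e s)Φ}(·)(g) ∈ H* has derivative 𝒯_{Φ_X}(·)(g) (Φ = φ ⊗ Φ_f a Fock pure
tensor is a smooth vector of ω with dω(X)Φ = (ω(X)φ) ⊗ Φ_f =: Φ_X, composed with the continuous linear
Φ ↦ 𝒯_Φ(·)(g) : 𝒮^κ → H*, referee-3 remark), [SETUP D7] `hH`: s ↦ R(e s)v has derivative Y v = dR(X)v
(v a Gårding vector; Getz–Hahn GTM 300, Lemma 4.2.2, pp. 75–76) — conclude
𝒯_{Φ_X}(v)(g) = −𝒯_Φ(Yv)(g) (l. 517 "⟨Xφ,v⟩ = −⟨φ,Xv⟩").  KERNEL: `clm_apply_deriv_eq_zero_of_const`;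
the read-back at s = 0 uses e 0 = 1, R 1 = 1 and `invariance` at h = 1 only. -/
theorem inf_invariance_pointwise
    (invariance : ∀ (h : G) (Φ : SK) (v : H), C.TΦc (C.omg h Φ) (C.R h v) = C.TΦc Φ v)
    {e : ℝ → G} (he : e 0 = 1) {Φ ΦX : SK} {p : P.Pt}
    (hF : HasDerivAt (fun s : ℝ => C4a.pointFunctional C P (C.omg (e s) Φ) p)
      (C4a.pointFunctional C P ΦX p) 0)
    {v Yv : H} (hH : HasDerivAt (fun s : ℝ => C.R (e s) v) Yv 0) :
    P.evalPt p (C.TΦc ΦX v) = - P.evalPt p (C.TΦc Φ Yv) := by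
  have hu : HasDerivAt (fun s : ℝ => restrictReal H (C4a.pointFunctional C P (C.omg (e s) Φ) p))
      (restrictReal H (C4a.pointFunctional C P ΦX p)) 0 :=
    (restrictReal H).hasFDerivAt.comp_hasDerivAt (0 : ℝ) hF
  have hconst : ∀ s : ℝ,
      restrictReal H (C4a.pointFunctional C P (C.omg (e s) Φ) p) (C.R (e s) v)
        = P.evalPt p (C.TΦc Φ v) := by
    intro s
    rw [restrictReal_apply, pointFunctional_apply, invariance]
  have hsum := clm_apply_deriv_eq_zero_of_const hu hH hconst
  simp only [restrictReal_apply, pointFunctional_apply] at hsum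
  rw [he, map_one, one_apply_eq_self] at hsum
  -- hsum : 𝒯_{Φ_X}(v)(g) + 𝒯_{ω(1)Φ}(Yv)(g) = 0
  have h1 : C.TΦc (C.omg 1 Φ) Yv = C.TΦc Φ Yv := by
    have h := invariance 1 Φ Yv
    rwa [map_one, one_apply_eq_self] at h
  rw [h1] at hsum
  exact eq_neg_of_add_eq_zero_left hsum

/-- **`inf_invariance` for a family of REAL directions, DISCHARGED** — the field shape of
`ArchCDatum.inf_invariance` for a family `X k` (on the Fock side) / `Y k` (on Gårding vectors) each
member of which comes with a one-parameter subgroup `e k` (X_k ∈ 𝔲(W)(L₀⊗ℝ) REAL, e k s = exp(sX_k);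
the docstring of `ArchCDatum.inf_invariance` records that a real basis suffices for `gen`). -/
theorem inf_invariance_of_oneParam
    (invariance : ∀ (h : G) (Φ : SK) (v : H), C.TΦc (C.omg h Φ) (C.R h v) = C.TΦc Φ v)
    {F FinIdx ιX : Type*} (ins : FinIdx → F → SK) (Sm : SigIdx → Set H)
    (X : ιX → F → F) (Y : ιX → H → H) (e : ιX → ℝ → G) (he : ∀ k, e k 0 = 1)
    (hF : ∀ (k : ιX) (f : FinIdx) (φ : F) (p : P.Pt),
      HasDerivAt (fun s : ℝ => C4a.pointFunctional C P (C.omg (e k s) (ins f φ)) p)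
        (C4a.pointFunctional C P (ins f (X k φ)) p) 0)
    (hH : ∀ (k : ιX) (i : SigIdx), ∀ v ∈ Sm i,
      HasDerivAt (fun s : ℝ => C.R (e k s) v) (Y k v) 0) :
    ∀ (f : FinIdx) (p : P.Pt) (k : ιX) (φ : F) (i : SigIdx), ∀ v ∈ Sm i,
      P.evalPt p (C.TΦc (ins f (X k φ)) v) = - P.evalPt p (C.TΦc (ins f φ) (Y k v)) :=
  fun f p k φ i v hv => inf_invariance_pointwise invariance (he k) (hF k f φ p) (hH k i v hv)

/-- [SETUP D4] φ ↦ 𝒯_{φ ⊗ Φ_f} as a ℂ-LINEAR map 𝓕^κ_∞ → (H →L C([G_U])), assembled from the two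
linearity fields `ins_add` / `ins_smul` of `ArchCDatum` (l. 378–381). -/
def insLinear {F FinIdx : Type*} [AddCommGroup F] [Module ℂ F] (ins : FinIdx → F → SK)
    (ins_add : ∀ (f : FinIdx) (φ ψ : F), C.TΦc (ins f (φ + ψ)) = C.TΦc (ins f φ) + C.TΦc (ins f ψ))
    (ins_smul : ∀ (f : FinIdx) (c : ℂ) (φ : F), C.TΦc (ins f (c • φ)) = c • C.TΦc (ins f φ))
    (f : FinIdx) : F →ₗ[ℂ] (H →L[ℂ] CG) where
  toFun ψ := C.TΦc (ins f ψ)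
  map_add' := ins_add f
  map_smul' := ins_smul f

/-- (Ported verbatim from the HodgeCMPerL package; no docstring in the source.) -/
@[simp] theorem insLinear_apply {F FinIdx : Type*} [AddCommGroup F] [Module ℂ F]
    (ins : FinIdx → F → SK)
    (ins_add : ∀ (f : FinIdx) (φ ψ : F), C.TΦc (ins f (φ + ψ)) = C.TΦc (ins f φ) + C.TΦc (ins f ψ))
    (ins_smul : ∀ (f : FinIdx) (c : ℂ) (φ : F), C.TΦc (ins f (c • φ)) = c • C.TΦc (ins f φ))
    (f : FinIdx) (ψ : F) : insLinear ins ins_add ins_smul f ψ = C.TΦc (ins f ψ) := rfl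

/-- **Linearity of the infinitesimal identity.**  If ⟨X_jφ, v⟩ = −⟨φ, Y_jv⟩ holds (at the point g,
for the pure tensor φ ⊗ Φ_f and the vector v) for every j ∈ s, then it holds for the ℂ-linear
combinations ∑ c_j X_j, ∑ c_j Y_j — from `ins_add`/`ins_smul` (linearity of φ ↦ 𝒯_{φ⊗Φ_f}) and the
linearity of 𝒯_Φ in v.  This is what lets the REAL one-parameter subgroups of U(W_∞) feed the
COMPLEX family ω(X_k), X_k ∈ 𝔲(W_∞)_ℂ (ladder operators), of the Fock side. -/
theorem inf_invariance_sum
    {F FinIdx : Type*} [AddCommGroup F] [Module ℂ F] (ins : FinIdx → F → SK)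
    (ins_add : ∀ (f : FinIdx) (φ ψ : F), C.TΦc (ins f (φ + ψ)) = C.TΦc (ins f φ) + C.TΦc (ins f ψ))
    (ins_smul : ∀ (f : FinIdx) (c : ℂ) (φ : F), C.TΦc (ins f (c • φ)) = c • C.TΦc (ins f φ))
    {ιR : Type*} (s : Finset ιR) (c : ιR → ℂ) (XR : ιR → F → F) (YR : ιR → H → H)
    {f : FinIdx} {p : P.Pt} {φ : F} {v : H}
    (h : ∀ j ∈ s,
      P.evalPt p (C.TΦc (ins f (XR j φ)) v) = - P.evalPt p (C.TΦc (ins f φ) (YR j v))) :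
    P.evalPt p (C.TΦc (ins f (∑ j ∈ s, c j • XR j φ)) v)
      = - P.evalPt p (C.TΦc (ins f φ) (∑ j ∈ s, c j • YR j v)) := by
  have hlin : C.TΦc (ins f (∑ j ∈ s, c j • XR j φ)) = ∑ j ∈ s, c j • C.TΦc (ins f (XR j φ)) := by
    have hs := map_sum (insLinear ins ins_add ins_smul f) (fun j => c j • XR j φ) s
    simpa only [insLinear_apply, map_smul] using hs
  have hL : P.evalPt p (C.TΦc (ins f (∑ j ∈ s, c j • XR j φ)) v)
      = ∑ j ∈ s, c j * P.evalPt p (C.TΦc (ins f (XR j φ)) v) := by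
    rw [hlin]
    simp [map_sum, smul_eq_mul]
  have hR : P.evalPt p (C.TΦc (ins f φ) (∑ j ∈ s, c j • YR j v))
      = ∑ j ∈ s, c j * P.evalPt p (C.TΦc (ins f φ) (YR j v)) := by
    simp only [map_sum, map_smul, smul_eq_mul]
  rw [hL, hR, ← Finset.sum_neg_distrib]
  refine Finset.sum_congr rfl fun j hj => ?_
  rw [h j hj, mul_neg]

/-- **`inf_invariance`, FIELD SHAPE, DISCHARGED for a complexified family** — concludes
`ArchCDatum.inf_invariance` / `FockArchBridge.inf_invariance` VERBATIM for a Fock-side family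
`X : ιX → F →ₗ[ℂ] F` and a Gårding-side family `Y : ιX → H → H` that are finite ℂ-linear
combinations (`supp`, `coef`, `hX`, `hY`) of REAL directions `XR j` / `YR j` carrying one-parameter
subgroups `e j` (e j 0 = 1) with the [SETUP D5]/[SETUP D7] derivatives `hF`/`hH` of
`inf_invariance_pointwise`; plus [NODE N21] `invariance` and the [SETUP D4] linearity fields
`ins_add`/`ins_smul`.  Intended: (XR j) = ω(X_j) for a real basis (X_j) of 𝔲(W)(L₀⊗ℝ) = ⊕_b 𝔲(W_b),
e j s = exp(sX_j) ∈ U(W)(L₀⊗ℝ) ⊂ U(W)(𝔸), YR j = dR(X_j) on Gårding vectors, and X k = the slot /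
ladder operators of the Fock model written in that basis. -/
theorem inf_invariance_of_realDirections
    (invariance : ∀ (h : G) (Φ : SK) (v : H), C.TΦc (C.omg h Φ) (C.R h v) = C.TΦc Φ v)
    {F FinIdx : Type*} [AddCommGroup F] [Module ℂ F] (ins : FinIdx → F → SK)
    (ins_add : ∀ (f : FinIdx) (φ ψ : F), C.TΦc (ins f (φ + ψ)) = C.TΦc (ins f φ) + C.TΦc (ins f ψ))
    (ins_smul : ∀ (f : FinIdx) (c : ℂ) (φ : F), C.TΦc (ins f (c • φ)) = c • C.TΦc (ins f φ))
    (Sm : SigIdx → Set H)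
    {ιR : Type*} (e : ιR → ℝ → G) (he : ∀ j, e j 0 = 1) (XR : ιR → F → F) (YR : ιR → H → H)
    (hF : ∀ (j : ιR) (f : FinIdx) (φ : F) (p : P.Pt),
      HasDerivAt (fun s : ℝ => C4a.pointFunctional C P (C.omg (e j s) (ins f φ)) p)
        (C4a.pointFunctional C P (ins f (XR j φ)) p) 0)
    (hH : ∀ (j : ιR) (i : SigIdx), ∀ v ∈ Sm i,
      HasDerivAt (fun s : ℝ => C.R (e j s) v) (YR j v) 0)
    {ιX : Type*} (X : ιX → F →ₗ[ℂ] F) (Y : ιX → H → H)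
    (supp : ιX → Finset ιR) (coef : ιX → ιR → ℂ)
    (hX : ∀ (k : ιX) (φ : F), X k φ = ∑ j ∈ supp k, coef k j • XR j φ)
    (hY : ∀ (k : ιX) (i : SigIdx), ∀ v ∈ Sm i, Y k v = ∑ j ∈ supp k, coef k j • YR j v) :
    ∀ (f : FinIdx) (p : P.Pt) (k : ιX) (φ : F) (i : SigIdx), ∀ v ∈ Sm i,
      P.evalPt p (C.TΦc (ins f (X k φ)) v) = - P.evalPt p (C.TΦc (ins f φ) (Y k v)) := by
  intro f p k φ i v hv
  rw [hX k φ, hY k i v hv]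
  exact inf_invariance_sum ins ins_add ins_smul (supp k) (coef k) XR YR
    (fun j _ => inf_invariance_pointwise invariance (he j) (hF j f φ p) (hH j i v hv))

/-! ### (c) By-name shape certificate -/

/-- **Shape certificate** (NO mathematical content: `A` already carries the two fields).  Rebuilding an
arbitrary `ArchCDatum` with `pure_detect` and `inf_invariance` REPLACED by `pure_detect_of_dense` and
`inf_invariance_of_realDirections` typechecks — so the two dischargers conclude the two [SETUP] fields
of `ArchC.lean` verbatim (and, with `pl.F/pl.X` for `F/X`, those of pv12-g2's `FockArchBridge`).  The
intended use is the other way round: a constructor of the datum from the adelic Weil representation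
(defs-needed D4/D5/D7) supplies the STRUCTURAL hypotheses listed here instead of the two inferences. -/
def ArchCDatum.withAnalytic (A : ArchCDatum C D P) [AddCommGroup SK] [Module ℂ SK]
    (TΦc_add : ∀ Φ Ψ : SK, C.TΦc (Φ + Ψ) = C.TΦc Φ + C.TΦc Ψ)
    (TΦc_smul : ∀ (c : ℂ) (Φ : SK), C.TΦc (c • Φ) = c • C.TΦc Φ)
    (cont : ∀ (p : P.Pt) (v : H), Continuous fun Φ : SK => P.evalPt p (C.TΦc Φ v))
    (dense : Dense (Submodule.span ℂ (Set.range fun q : A.FinIdx × A.F => A.ins q.1 q.2) : Set SK))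
    {ιR : Type*} (e : ιR → ℝ → G) (he : ∀ j, e j 0 = 1) (XR : ιR → A.F → A.F) (YR : ιR → H → H)
    (hF : ∀ (j : ιR) (f : A.FinIdx) (φ : A.F) (p : P.Pt),
      HasDerivAt (fun s : ℝ => C4a.pointFunctional C P (C.omg (e j s) (A.ins f φ)) p)
        (C4a.pointFunctional C P (A.ins f (XR j φ)) p) 0)
    (hH : ∀ (j : ιR) (i : SigIdx), ∀ v ∈ A.Sm i,
      HasDerivAt (fun s : ℝ => C.R (e j s) v) (YR j v) 0)
    (supp : A.ιX → Finset ιR) (coef : A.ιX → ιR → ℂ)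
    (hX : ∀ (k : A.ιX) (φ : A.F), A.X k φ = ∑ j ∈ supp k, coef k j • XR j φ)
    (hY : ∀ (k : A.ιX) (i : SigIdx), ∀ v ∈ A.Sm i, A.Y k v = ∑ j ∈ supp k, coef k j • YR j v) :
    ArchCDatum C D P :=
  { A with
    pure_detect := pure_detect_of_dense TΦc_add TΦc_smul cont A.ins dense
    inf_invariance := inf_invariance_of_realDirections A.invariance A.ins A.ins_add A.ins_smul A.Sm
      e he XR YR hF hH A.X A.Y supp coef hX hY }

/-- The certificate changes nothing observable: the rebuilt datum has the same Fock space, the same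
distinguished vector and the same torus character (all `rfl`). -/
theorem ArchCDatum.withAnalytic_F (A : ArchCDatum C D P) [AddCommGroup SK] [Module ℂ SK]
    (TΦc_add : ∀ Φ Ψ : SK, C.TΦc (Φ + Ψ) = C.TΦc Φ + C.TΦc Ψ)
    (TΦc_smul : ∀ (c : ℂ) (Φ : SK), C.TΦc (c • Φ) = c • C.TΦc Φ)
    (cont : ∀ (p : P.Pt) (v : H), Continuous fun Φ : SK => P.evalPt p (C.TΦc Φ v))
    (dense : Dense (Submodule.span ℂ (Set.range fun q : A.FinIdx × A.F => A.ins q.1 q.2) : Set SK))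
    {ιR : Type*} (e : ιR → ℝ → G) (he : ∀ j, e j 0 = 1) (XR : ιR → A.F → A.F) (YR : ιR → H → H)
    (hF : ∀ (j : ιR) (f : A.FinIdx) (φ : A.F) (p : P.Pt),
      HasDerivAt (fun s : ℝ => C4a.pointFunctional C P (C.omg (e j s) (A.ins f φ)) p)
        (C4a.pointFunctional C P (A.ins f (XR j φ)) p) 0)
    (hH : ∀ (j : ιR) (i : SigIdx), ∀ v ∈ A.Sm i,
      HasDerivAt (fun s : ℝ => C.R (e j s) v) (YR j v) 0)
    (supp : A.ιX → Finset ιR) (coef : A.ιX → ιR → ℂ)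
    (hX : ∀ (k : A.ιX) (φ : A.F), A.X k φ = ∑ j ∈ supp k, coef k j • XR j φ)
    (hY : ∀ (k : A.ιX) (i : SigIdx), ∀ v ∈ A.Sm i, A.Y k v = ∑ j ∈ supp k, coef k j • YR j v) :
    (A.withAnalytic TΦc_add TΦc_smul cont dense e he XR YR hF hH supp coef hX hY).F = A.F ∧
    (A.withAnalytic TΦc_add TΦc_smul cont dense e he XR YR hF hH supp coef hX hY).w = A.w :=
  ⟨rfl, rfl⟩

end Frozen

end PerL34.ArchC

end HodgeCM
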